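/-
Copyright (c) 2026 the pub-hodgecm-mathlib formalisation cell (harness21).  Prover seat hodgecm-mathlib-LH7-p08 (g0) (re-dealt to strike line L3 `stub_N6nsDyadic` by director
s1969 (a)), Track A «(D-RAM) FOUR-FRAME» squad, helper lane on h413 = stmt-HodgeConjecture-24833 (count-neutral).  β-BOARD v1 row R8 ∕ (P5) «H `(2ρ,2ρ,2ρ)`», FILE 5b: on `S_F` of a
core-hanging lattice the two-slot linear form `u₀·f·g_α + u₁·g_β` reads through the REDUCED form `L♭(u) = (1+f)g_α·u₂ + (g_β − g_α)·u₁`, and `θ = ω(G)·ω(L♭)` is a CHARACTER of `S_F`;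
the elements `u_t = (1 + t∕f, 1 − t, 1)` of `S_F`.  2026-09-04.
-/
import Summits.HodgeConjecture.HodgeConjecture.Theorems.F0P3cDyRamLabelledOddCoreHangingCollapsedRead   -- ★ p861966 (this seat, FILE 4a): brings ★ FILE 2a, ★ κH-A2 (`mem_fixedUnitStabilizer_latt_glued_iff`), ★ ω-toolkit
import HarnessLib

/-!
# Crux `H413`, line LH4 «(D-RAM) FOUR-FRAME» — (β) table, β-BOARD row R8 ∕ (P5), FILE 5b: «THE REDUCED LINEAR FORM `L♭(u) = (1+f)·g_α·u₂ + (g_β − g_α)·u₁` ON `S_F` OF A CORE-HANGING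
# LATTICE: `ω(u₀·f·g_α + u₁·g_β) = ω(L♭(u))`, AND `θ := ω(G)·ω(L♭)` IS MULTIPLICATIVE ON `S_F`» (the character of the (β) label at every depth of the third root)

Cell `hodgecm-mathlib` (D-0151), FLOOR 0, crux item H413 = `stmt-HodgeConjecture-24833`, route `HCCMUnconditional`; squad F0∕P3c∕LH4.  THEOREMS ONLY (no `def`, no instance, no
notation, no `sorry`, default heartbeats); ★-only imports; lane `--supports stmt-HodgeConjecture-24833 --as helper` (count-neutral); pays NO row, states NO law.

THE MATHEMATICS (this seat's MATH NOTE 2026-09-04 21:33Z on LEDGER #19 (v)∕(iii)).  Let `M = latt(1 0 0; x ϖ^ρ 0; xζ+f·xζ ϖ^ρζ ϖ^{2ρ})` be a core-hanging member (`x, ζ` units, `f` a fixed unit).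
The ★ `S_F` letters (★ κH-A2 `mem_fixedUnitStabilizer_latt_glued_iff` at `s = 0`, lineariser `1∕f`) are `|u₂ − u₁| ≤ |ϖ|^ρ` and `|f⁻¹(u₂−u₁) + (u₂−u₀)| ≤ |ϖ|^{2ρ}`, i.e.
`u₀·f + u₁ ≡ (1+f)·u₂ (mod 𝔭^{2ρ}·unit)` (§0; conversely the fixed unit triples `u_t := (1 + t∕f, 1 − t, 1)`, `t ∈ 𝔭^ρ` fixed, lie in `S_F`).  Hence for fixed `g_α, g_β` with
`G := f·g_α + g_β ≠ 0`, `|ϖ|^{2ρ}|g_α| ≤ |ϖ|^{2d−1}|G|` and `|g_β − g_α| ≤ |G|`: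
* §1 `u₀·f·g_α + u₁·g_β = L♭(u) + g_α·((u₀f + u₁) − (1+f)u₂)`, `L♭(u) := (1+f)·g_α·u₂ + (g_β − g_α)·u₁ = u₂·G + (g_β − g_α)(u₁ − u₂)`, `|L♭(u)| = |G|`, so
  **`ω(u₀·f·g_α + u₁·g_β) = ω(L♭(u))`** (★ toolkit §3: the quotient is a fixed unit `≡ 1 (mod 𝔭^{2d−1})`) — the (β) label (★ p861388 FILE 2a) reads through `L♭`, which no longer
  involves `u₀`;
* §2 **`θ(u) := ω(G)·ω(L♭(u))` IS MULTIPLICATIVE ON `S_F`**: `L♭(u)·L♭(u′) − G·L♭(u·u′) = −(1+f)g_α·(g_β − g_α)·(u₂ − u₁)(u′₂ − u′₁)`, of size `≤ |g_α||G|·|ϖ|^{2ρ} ≤ |ϖ|^{2d−1}|G|²`.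
With FILE 5a (★ HEAD A for a character label) this gives the per-lattice labelled-odd value `w∕2 · ω(D_i)·ω(G)·[ω_i·θ ≡ 1 on S_F]` at every depth; the three brackets are evaluated in
FILE 5b′ (`…CoreHangingCharacterWindows`): slot 2 ⟺ `|ϖ|^ρ·|g_β − g_α| ≤ |ϖ|^{2d−1}|G|`, slots 0∕1 ⟺ `2d − 1 ≤ ρ` (witnesses `u_t` of §0 otherwise).
HONEST LABEL.  Count-neutral (`--supports`); the windows (5b′), the shallow∕equilateral H rows, `hRest`, (T3), (β-BAL), (β), T₊ stay OPEN; `HC_CM` is proved only modulo the 7 printed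
citations (2 remaining named inputs: hLiu418 = `stmt-HodgeConjecture-24832`, h413 = `stmt-HodgeConjecture-24833`) until rung 0 closes.

## References
* [Kottwitz1986BaseChangeUnits] R. E. Kottwitz, *Base change for unit elements of Hecke algebras*, Compositio Math. 60 (1986), §1 pp. 240–241 (signed lattice counts modulo the torus).
* [LanglandsShelstad1987] R. P. Langlands, D. Shelstad, *On the definition of transfer factors*, Math. Ann. 278 (1987), §3.
* [Rogawski1990] J. D. Rogawski, *Automorphic Representations of Unitary Groups in Three Variables*, Ann. of Math. Stud. 123 (1990), §4.9 Prop. 4.9.1 (a)(b) p. 55, §4.10 p. 58.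
* [Serre1979] J.-P. Serre, *Local Fields*, GTM 67 (1979), Ch. V §3 Cor. 3, Ch. XV §2 (the conductor of the quadratic character).
-/

set_option autoImplicit false

noncomputable section

namespace Summit.HodgeConjecture.HodgeConjecture.Cruxes.H413.F0P3cDyRamLabelledOddCoreHangingCharacterRead

open Matrix WithZero
open Literature.NumberTheory.Automorphic Literature.NumberTheory.Automorphic.HermitianLattice Literature.NumberTheory.Automorphic.UnitaryGroup
open Literature.NumberTheory.Automorphic.UnitaryLatticeTree Literature.NumberTheory.Automorphic.UnitaryThreeFourFrame
open Literature.NumberTheory.LocalFields Literature.NumberTheory.LocalFields.WildQuadraticDatum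
open Summit.HodgeConjecture.HodgeConjecture.Cruxes.H413.F0P3cDyRamFourFramePieces
open Summit.HodgeConjecture.HodgeConjecture.Cruxes.H413.F0P3cDyRamDiagonalTorusDefs
open Summit.HodgeConjecture.HodgeConjecture.Cruxes.H413.F0P3cDyRamDiagonalGluedFixedStabiliser (mem_fixedUnitStabilizer_latt_glued_iff)
open Summit.HodgeConjecture.HodgeConjecture.Cruxes.H413.F0P3cDyRamFixedCountDiagonalModel (normSign_mul_norm)
open scoped Valued WithZero Matrix MatrixGroups

variable {K : Type} [Field K] [Valued K ℤᵐ⁰]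

/-! ## §0  The `S_F` letters of a core-hanging member, and the elements `u_t = (1 + t∕f, 1 − t, 1)` -/

/-- **THE `S_F` LETTERS**: for `u ∈ S_F(latt V)`, `V = (1 0 0; x ϖ^ρ 0; xζ+f·xζ ϖ^ρζ ϖ^{2ρ})` (`x, ζ, f` units): `|u₂ − u₁| ≤ |ϖ|^ρ` and `|(u₀·f + u₁) − (1+f)·u₂| ≤ |ϖ|^{2ρ}`
(★ κH-A2 `mem_fixedUnitStabilizer_latt_glued_iff` at `s = 0` with lineariser `1∕f`). [cite: Kottwitz1986BaseChangeUnits, §1 pp. 240–241] -/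
theorem v_letters_of_mem_fixedUnitStabilizer {σ : K →+* K} {ϖ : K} (hϖ0 : ϖ ≠ 0) (hϖ1 : Valued.v ϖ ≤ 1)
    {ρ : ℕ} {x ζ f : K} (hx : Valued.v x = 1) (hζ : Valued.v ζ = 1) (hf : Valued.v f = 1)
    (V : GL (Fin 3) K) (hV : (V : Matrix (Fin 3) (Fin 3) K) = !![1, 0, 0; x, ϖ ^ ρ, 0; x * ζ + f * (x * ζ), ϖ ^ ρ * ζ, ϖ ^ (2 * ρ)])
    {u : Fin 3 → Kˣ} (hu : u ∈ fixedUnitStabilizer σ (latt (V : Matrix (Fin 3) (Fin 3) K))) :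
    Valued.v (((u 2 : Kˣ) : K) - u 1) ≤ Valued.v ϖ ^ ρ ∧ Valued.v ((((u 0 : Kˣ) : K) * f + u 1) - (1 + f) * ((u 2 : Kˣ) : K)) ≤ Valued.v ϖ ^ (2 * ρ) := by
  have hf0 : f ≠ 0 := fun h => by rw [h, map_zero] at hf; exact zero_ne_one hf
  have hV0 : (V : Matrix (Fin 3) (Fin 3) K) = !![1, 0, 0; x, ϖ ^ ρ, 0; x * ζ + f * (x * ζ), ϖ ^ ρ * ζ, ϖ ^ (2 * ρ + 0)] := by rw [Nat.add_zero]; exact hV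
  obtain ⟨h10, h20⟩ := (mem_fixedUnitStabilizer_latt_glued_iff (σ := σ) hϖ0 hϖ1 ρ 0 (x := x) (ζ := ζ) (y'' := f * (x * ζ)) (g := f⁻¹) hx hζ
    (by rw [pow_zero, map_mul, map_mul, hf, hx, hζ, one_mul, one_mul]) (by rw [pow_zero, mul_one, map_inv₀, hf, inv_one])
    (by rw [show x * ζ - f⁻¹ * (f * (x * ζ)) = 0 by rw [← mul_assoc, inv_mul_cancel₀ hf0, one_mul, sub_self], map_zero]; exact zero_le) V hV0 hu.2).1 hu
  rw [Nat.add_zero] at h10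
  refine ⟨h10, ?_⟩
  have e : (((u 0 : Kˣ) : K) * f + u 1) - (1 + f) * ((u 2 : Kˣ) : K) = -(f * (f⁻¹ * (((u 2 : Kˣ) : K) - u 1) + (((u 2 : Kˣ) : K) - u 0))) := by
    field_simp; ring
  rw [e, Valuation.map_neg, map_mul, hf, one_mul]; exact h20

/-- **THE ELEMENTS `u_t = (1 + t∕f, 1 − t, 1) ∈ S_F`** for every fixed `t` with `|t| ≤ |ϖ|^ρ`, `ρ ≥ 1` (both `S_F` letters hold with room: `|u₂ − u₁| = |t|`, `f⁻¹(u₂−u₁) + (u₂−u₀) = 0`).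
[cite: Kottwitz1986BaseChangeUnits, §1 pp. 240–241] -/
theorem exists_mem_fixedUnitStabilizer_updown {σ : K →+* K} {ϖ : K} (hϖ : Valued.v ϖ = exp (-1 : ℤ))
    {ρ : ℕ} (hρ : 1 ≤ ρ) {x ζ f : K} (hx : Valued.v x = 1) (hζ : Valued.v ζ = 1) (hσf : σ f = f) (hf : Valued.v f = 1)
    (V : GL (Fin 3) K) (hV : (V : Matrix (Fin 3) (Fin 3) K) = !![1, 0, 0; x, ϖ ^ ρ, 0; x * ζ + f * (x * ζ), ϖ ^ ρ * ζ, ϖ ^ (2 * ρ)])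
    {t : K} (hσt : σ t = t) (ht : Valued.v t ≤ Valued.v ϖ ^ ρ) :
    ∃ u : Fin 3 → Kˣ, u ∈ fixedUnitStabilizer σ (latt (V : Matrix (Fin 3) (Fin 3) K)) ∧
      ((u 0 : Kˣ) : K) = 1 + t / f ∧ ((u 1 : Kˣ) : K) = 1 - t ∧ ((u 2 : Kˣ) : K) = 1 := by
  have hϖ0 : ϖ ≠ 0 := fun h => by rw [h, map_zero] at hϖ; exact (exp_ne_zero hϖ.symm).elim
  have hϖ1 : Valued.v ϖ < 1 := by rw [hϖ, ← exp_zero, exp_lt_exp]; norm_num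
  have hf0 : f ≠ 0 := fun h => by rw [h, map_zero] at hf; exact zero_ne_one hf
  have htlt : Valued.v t < 1 := ht.trans_lt (pow_lt_one₀ zero_le hϖ1 (by omega))
  -- the two unit coordinates
  have hva : Valued.v (1 + t / f) = 1 := by
    rw [Valuation.map_add_eq_of_lt_left _ (by rw [map_one, map_div₀, hf, div_one]; exact htlt), map_one]
  have hvb : Valued.v (1 - t) = 1 := by
    rw [sub_eq_add_neg, Valuation.map_add_eq_of_lt_left _ (by rw [map_one, Valuation.map_neg]; exact htlt), map_one]
  have ha0 : 1 + t / f ≠ 0 := fun h => by rw [h, map_zero] at hva; exact zero_ne_one hva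
  have hb0 : 1 - t ≠ 0 := fun h => by rw [h, map_zero] at hvb; exact zero_ne_one hvb
  refine ⟨![Units.mk0 _ ha0, Units.mk0 _ hb0, 1], ?_, rfl, rfl, rfl⟩
  have huT : (![Units.mk0 _ ha0, Units.mk0 _ hb0, 1] : Fin 3 → Kˣ) ∈ fixedUnitTorus σ 3 := by
    rw [mem_fixedUnitTorus_iff]
    refine ⟨fun j => ?_, fun j => ?_⟩ <;> fin_cases j
    · show Valued.v (1 + t / f) = 1; exact hva
    · show Valued.v (1 - t) = 1; exact hvb
    · show Valued.v ((1 : Kˣ) : K) = 1; rw [Units.val_one, map_one]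
    · show σ (1 + t / f) = 1 + t / f; rw [map_add, map_one, map_div₀, hσt, hσf]
    · show σ (1 - t) = 1 - t; rw [map_sub, map_one, hσt]
    · show σ ((1 : Kˣ) : K) = (1 : Kˣ); rw [Units.val_one, map_one]
  have hV0 : (V : Matrix (Fin 3) (Fin 3) K) = !![1, 0, 0; x, ϖ ^ ρ, 0; x * ζ + f * (x * ζ), ϖ ^ ρ * ζ, ϖ ^ (2 * ρ + 0)] := by rw [Nat.add_zero]; exact hV
  refine (mem_fixedUnitStabilizer_latt_glued_iff (σ := σ) hϖ0 hϖ1.le ρ 0 (x := x) (ζ := ζ) (y'' := f * (x * ζ)) (g := f⁻¹) hx hζ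
    (by rw [pow_zero, map_mul, map_mul, hf, hx, hζ, one_mul, one_mul]) (by rw [pow_zero, mul_one, map_inv₀, hf, inv_one])
    (by rw [show x * ζ - f⁻¹ * (f * (x * ζ)) = 0 by rw [← mul_assoc, inv_mul_cancel₀ hf0, one_mul, sub_self], map_zero]; exact zero_le) V hV0 huT).2 ⟨?_, ?_⟩
  · show Valued.v (((1 : Kˣ) : K) - (1 - t)) ≤ Valued.v ϖ ^ (ρ + 0)
    rw [Units.val_one, sub_sub_cancel, Nat.add_zero]; exact ht
  · show Valued.v (f⁻¹ * (((1 : Kˣ) : K) - (1 - t)) + (((1 : Kˣ) : K) - (1 + t / f))) ≤ Valued.v ϖ ^ (2 * ρ)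
    rw [Units.val_one, show f⁻¹ * (1 - (1 - t)) + (1 - (1 + t / f)) = (0 : K) by field_simp; ring, map_zero]; exact zero_le

/-! ## §1  The bridge: `ω(u₀·f·g_α + u₁·g_β) = ω(L♭(u))` on `S_F` -/

/-- **`|L♭(u)| = |G|` and `L♭(u) ≠ 0`** on `S_F`, `L♭(u) = (1+f)g_α·u₂ + (g_β − g_α)·u₁ = u₂·G + (g_β − g_α)(u₁ − u₂)`, when `|g_β − g_α| ≤ |G|`, `ρ ≥ 1`.
[cite: Kottwitz1986BaseChangeUnits, §1 pp. 240–241] -/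
theorem v_reduced_eq {σ : K →+* K} {ϖ : K} (hϖ : Valued.v ϖ = exp (-1 : ℤ))
    {ρ : ℕ} (hρ : 1 ≤ ρ) {x ζ f : K} (hx : Valued.v x = 1) (hζ : Valued.v ζ = 1) (hf : Valued.v f = 1)
    (V : GL (Fin 3) K) (hV : (V : Matrix (Fin 3) (Fin 3) K) = !![1, 0, 0; x, ϖ ^ ρ, 0; x * ζ + f * (x * ζ), ϖ ^ ρ * ζ, ϖ ^ (2 * ρ)])
    {gα gβ : K} (hG0 : f * gα + gβ ≠ 0) (hb : Valued.v (gβ - gα) ≤ Valued.v (f * gα + gβ))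
    {u : Fin 3 → Kˣ} (hu : u ∈ fixedUnitStabilizer σ (latt (V : Matrix (Fin 3) (Fin 3) K))) :
    Valued.v ((1 + f) * gα * ((u 2 : Kˣ) : K) + (gβ - gα) * ((u 1 : Kˣ) : K)) = Valued.v (f * gα + gβ) ∧
      (1 + f) * gα * ((u 2 : Kˣ) : K) + (gβ - gα) * ((u 1 : Kˣ) : K) ≠ 0 := by
  have hϖ0 : ϖ ≠ 0 := fun h => by rw [h, map_zero] at hϖ; exact (exp_ne_zero hϖ.symm).elim
  have hϖ1 : Valued.v ϖ < 1 := by rw [hϖ, ← exp_zero, exp_lt_exp]; norm_num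
  have huv : ∀ j, Valued.v ((u j : Kˣ) : K) = 1 := fun j => ((mem_fixedUnitTorus_iff σ u).1 hu.2).1 j
  obtain ⟨h10, -⟩ := v_letters_of_mem_fixedUnitStabilizer hϖ0 hϖ1.le hx hζ hf V hV hu
  have hvG : 0 < Valued.v (f * gα + gβ) := (Valuation.pos_iff _).2 hG0
  have e : (1 + f) * gα * ((u 2 : Kˣ) : K) + (gβ - gα) * ((u 1 : Kˣ) : K) = ((u 2 : Kˣ) : K) * (f * gα + gβ) + -((gβ - gα) * (((u 2 : Kˣ) : K) - u 1)) := by ring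
  have hmain : Valued.v (((u 2 : Kˣ) : K) * (f * gα + gβ)) = Valued.v (f * gα + gβ) := by rw [map_mul, huv 2, one_mul]
  have hsmall : Valued.v (-((gβ - gα) * (((u 2 : Kˣ) : K) - u 1))) < Valued.v (((u 2 : Kˣ) : K) * (f * gα + gβ)) := by
    rw [Valuation.map_neg, map_mul, hmain]
    calc Valued.v (gβ - gα) * Valued.v (((u 2 : Kˣ) : K) - u 1) ≤ Valued.v (f * gα + gβ) * Valued.v ϖ ^ ρ := mul_le_mul' hb h10
      _ < Valued.v (f * gα + gβ) * 1 := mul_lt_mul_of_pos_left (pow_lt_one₀ zero_le hϖ1 (by omega)) hvG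
      _ = Valued.v (f * gα + gβ) := mul_one _
  have hv : Valued.v ((1 + f) * gα * ((u 2 : Kˣ) : K) + (gβ - gα) * ((u 1 : Kˣ) : K)) = Valued.v (f * gα + gβ) := by
    rw [e, Valuation.map_add_eq_of_lt_left _ hsmall, hmain]
  exact ⟨hv, fun h => by rw [h, map_zero] at hv; exact hvG.ne hv⟩

/-- **THE BRIDGE.**  Ramified datum on a complete field; core-hanging member `latt V` (`x, ζ` units, `f` a fixed unit), `ρ ≥ 1`; fixed `g_α, g_β` with `G := f·g_α + g_β ≠ 0`,
`|ϖ|^{2ρ}·|g_α| ≤ |ϖ|^{2d−1}·|G|` and `|g_β − g_α| ≤ |G|`.  Then for every `u ∈ S_F(latt V)`: `u₀·f·g_α + u₁·g_β ≠ 0` and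
**`normSign σ (u₀·f·g_α + u₁·g_β) = normSign σ ((1+f)·g_α·u₂ + (g_β − g_α)·u₁)`** (`u₀fg_α + u₁g_β = L♭(u) + g_α·((u₀f+u₁) − (1+f)u₂)`, §0, ★ toolkit §3–§4).
[cite: Serre1979, Ch. XV §2] [cite: Kottwitz1986BaseChangeUnits, §1 pp. 240–241] -/
theorem normSign_twoSlot_eq_reduced [CompleteSpace K] [Finite 𝓀[K]] {σ : K →+* K} {ϖ : K} {d t : ℕ} (hD : IsRamifiedQuadraticDatum σ ϖ d t)
    {ρ : ℕ} (hρ : 1 ≤ ρ) {x ζ f : K} (hx : Valued.v x = 1) (hζ : Valued.v ζ = 1) (hσf : σ f = f) (hf : Valued.v f = 1)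
    (V : GL (Fin 3) K) (hV : (V : Matrix (Fin 3) (Fin 3) K) = !![1, 0, 0; x, ϖ ^ ρ, 0; x * ζ + f * (x * ζ), ϖ ^ ρ * ζ, ϖ ^ (2 * ρ)])
    {gα gβ : K} (hσgα : σ gα = gα) (hσgβ : σ gβ = gβ) (hG0 : f * gα + gβ ≠ 0)
    (hdom : Valued.v ϖ ^ (2 * ρ) * Valued.v gα ≤ Valued.v ϖ ^ (2 * d - 1) * Valued.v (f * gα + gβ))
    (hb : Valued.v (gβ - gα) ≤ Valued.v (f * gα + gβ))
    {u : Fin 3 → Kˣ} (hu : u ∈ fixedUnitStabilizer σ (latt (V : Matrix (Fin 3) (Fin 3) K))) :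
    ((u 0 : Kˣ) : K) * f * gα + ((u 1 : Kˣ) : K) * gβ ≠ 0 ∧
      normSign σ (((u 0 : Kˣ) : K) * f * gα + ((u 1 : Kˣ) : K) * gβ) = normSign σ ((1 + f) * gα * ((u 2 : Kˣ) : K) + (gβ - gα) * ((u 1 : Kˣ) : K)) := by
  obtain ⟨hσ, hvσ, hϖ, hfix, hdd, hd1, -⟩ := id hD
  have hϖ0 : ϖ ≠ 0 := fun h => by rw [h, map_zero] at hϖ; exact (exp_ne_zero hϖ.symm).elim
  have hϖ1 : Valued.v ϖ < 1 := by rw [hϖ, ← exp_zero, exp_lt_exp]; norm_num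
  have hufix : ∀ j, σ ((u j : Kˣ) : K) = u j := fun j => ((mem_fixedUnitTorus_iff σ u).1 hu.2).2 j
  obtain ⟨-, h20⟩ := v_letters_of_mem_fixedUnitStabilizer hϖ0 hϖ1.le hx hζ hf V hV hu
  obtain ⟨hvL, hL0⟩ := v_reduced_eq (σ := σ) hϖ hρ hx hζ hf V hV hG0 hb hu
  -- `L = L♭ + g_α·E₁`
  obtain ⟨E, hE⟩ : ∃ E : K, E = gα * ((((u 0 : Kˣ) : K) * f + u 1) - (1 + f) * ((u 2 : Kˣ) : K)) := ⟨_, rfl⟩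
  have hdec : ((u 0 : Kˣ) : K) * f * gα + ((u 1 : Kˣ) : K) * gβ = ((1 + f) * gα * ((u 2 : Kˣ) : K) + (gβ - gα) * ((u 1 : Kˣ) : K)) + E := by rw [hE]; ring
  have hvG : 0 < Valued.v (f * gα + gβ) := (Valuation.pos_iff _).2 hG0
  have hEle : Valued.v E ≤ Valued.v ϖ ^ (2 * d - 1) * Valued.v (f * gα + gβ) := by
    rw [hE, map_mul, mul_comm]
    exact (mul_le_mul' h20 le_rfl).trans hdom
  -- `y := 1 + E∕L♭` is a fixed unit `≡ 1 (mod 𝔭^{2d−1})`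
  obtain ⟨y, hy⟩ : ∃ y : K, y = 1 + E / ((1 + f) * gα * ((u 2 : Kˣ) : K) + (gβ - gα) * ((u 1 : Kˣ) : K)) := ⟨_, rfl⟩
  have hσL : σ ((1 + f) * gα * ((u 2 : Kˣ) : K) + (gβ - gα) * ((u 1 : Kˣ) : K)) = (1 + f) * gα * ((u 2 : Kˣ) : K) + (gβ - gα) * ((u 1 : Kˣ) : K) := by
    simp only [map_add, map_mul, map_sub, map_one, hσf, hσgα, hσgβ, hufix]
  have hσE : σ E = E := by rw [hE]; simp only [map_add, map_mul, map_sub, map_one, hσf, hufix, hσgα]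
  have hσy : σ y = y := by rw [hy, map_add, map_one, map_div₀, hσE, hσL]
  have hy1 : Valued.v (y - 1) ≤ Valued.v ϖ ^ (2 * d - 1) := by
    rw [hy, add_sub_cancel_left, map_div₀, hvL, div_le_iff₀ hvG]
    exact hEle
  have hωy : normSign σ y = 1 := normSign_eq_one_of_fixed_of_v_sub_one_le hD hσy le_rfl hy1
  have hlt : Valued.v ϖ ^ (2 * d - 1) < 1 := pow_lt_one₀ zero_le hϖ1 (by omega)
  have hvy : Valued.v y = 1 := by
    have e : y = 1 + (y - 1) := by ring
    rw [e]; exact Valuation.map_one_add_of_lt _ (hy1.trans_lt hlt)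
  have hy0 : y ≠ 0 := fun h0 => by rw [h0, map_zero] at hvy; exact zero_ne_one hvy
  have hfac : ((u 0 : Kˣ) : K) * f * gα + ((u 1 : Kˣ) : K) * gβ = ((1 + f) * gα * ((u 2 : Kˣ) : K) + (gβ - gα) * ((u 1 : Kˣ) : K)) * y := by
    have e : ((1 + f) * gα * ((u 2 : Kˣ) : K) + (gβ - gα) * ((u 1 : Kˣ) : K)) * y = ((1 + f) * gα * ((u 2 : Kˣ) : K) + (gβ - gα) * ((u 1 : Kˣ) : K)) + E := by
      rw [hy, mul_add, mul_one, mul_div_cancel₀ _ hL0]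
    rw [e]; exact hdec
  refine ⟨by rw [hfac]; exact mul_ne_zero hL0 hy0, ?_⟩
  rw [hfac, normSign_mul_of_fixed hD hσL hσy hL0 hy0, hωy, mul_one]

/-! ## §2  `θ = ω(G)·ω(L♭)` is multiplicative on `S_F` -/

/-- **`θ(u·u′) = θ(u)·θ(u′)` ON `S_F`**, `θ(u) := ω(f·g_α + g_β)·ω((1+f)·g_α·u₂ + (g_β − g_α)·u₁)` — ramified datum on a complete field, core-hanging member `latt V`, `ρ ≥ 1`, fixed `g_α, g_β`
with `G ≠ 0`, `|ϖ|^{2ρ}|g_α| ≤ |ϖ|^{2d−1}|G|`, `|g_β − g_α| ≤ |G|` (the defect `L♭(u)L♭(u′) − G·L♭(uu′) = −(1+f)g_α(g_β − g_α)(u₂−u₁)(u′₂−u′₁)` has size `≤ |ϖ|^{2d−1}|G|²`; ★ toolkit §3–§4).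
[cite: Serre1979, Ch. XV §2] [cite: Kottwitz1986BaseChangeUnits, §1 pp. 240–241] [cite: LanglandsShelstad1987, §3] -/
theorem theta_mul [CompleteSpace K] [Finite 𝓀[K]] {σ : K →+* K} {ϖ : K} {d t : ℕ} (hD : IsRamifiedQuadraticDatum σ ϖ d t)
    {ρ : ℕ} (hρ : 1 ≤ ρ) {x ζ f : K} (hx : Valued.v x = 1) (hζ : Valued.v ζ = 1) (hσf : σ f = f) (hf : Valued.v f = 1)
    (V : GL (Fin 3) K) (hV : (V : Matrix (Fin 3) (Fin 3) K) = !![1, 0, 0; x, ϖ ^ ρ, 0; x * ζ + f * (x * ζ), ϖ ^ ρ * ζ, ϖ ^ (2 * ρ)])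
    {gα gβ : K} (hσgα : σ gα = gα) (hσgβ : σ gβ = gβ) (hG0 : f * gα + gβ ≠ 0)
    (hdom : Valued.v ϖ ^ (2 * ρ) * Valued.v gα ≤ Valued.v ϖ ^ (2 * d - 1) * Valued.v (f * gα + gβ))
    (hb : Valued.v (gβ - gα) ≤ Valued.v (f * gα + gβ))
    {u u' : Fin 3 → Kˣ} (hu : u ∈ fixedUnitStabilizer σ (latt (V : Matrix (Fin 3) (Fin 3) K))) (hu' : u' ∈ fixedUnitStabilizer σ (latt (V : Matrix (Fin 3) (Fin 3) K))) :
    normSign σ (f * gα + gβ) * normSign σ ((1 + f) * gα * (((u * u') 2 : Kˣ) : K) + (gβ - gα) * (((u * u') 1 : Kˣ) : K)) =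
      (normSign σ (f * gα + gβ) * normSign σ ((1 + f) * gα * ((u 2 : Kˣ) : K) + (gβ - gα) * ((u 1 : Kˣ) : K))) *
        (normSign σ (f * gα + gβ) * normSign σ ((1 + f) * gα * ((u' 2 : Kˣ) : K) + (gβ - gα) * ((u' 1 : Kˣ) : K))) := by
  obtain ⟨hσ, hvσ, hϖ, hfix, hdd, hd1, -⟩ := id hD
  have hϖ0 : ϖ ≠ 0 := fun h => by rw [h, map_zero] at hϖ; exact (exp_ne_zero hϖ.symm).elim
  have hϖ1 : Valued.v ϖ < 1 := by rw [hϖ, ← exp_zero, exp_lt_exp]; norm_num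
  have hufix : ∀ j, σ ((u j : Kˣ) : K) = u j := fun j => ((mem_fixedUnitTorus_iff σ u).1 hu.2).2 j
  have hu'fix : ∀ j, σ ((u' j : Kˣ) : K) = u' j := fun j => ((mem_fixedUnitTorus_iff σ u').1 hu'.2).2 j
  obtain ⟨h10, -⟩ := v_letters_of_mem_fixedUnitStabilizer hϖ0 hϖ1.le hx hζ hf V hV hu
  obtain ⟨h10', -⟩ := v_letters_of_mem_fixedUnitStabilizer hϖ0 hϖ1.le hx hζ hf V hV hu'
  obtain ⟨hvL, hL0⟩ := v_reduced_eq (σ := σ) hϖ hρ hx hζ hf V hV hG0 hb hu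
  obtain ⟨hvL', hL0'⟩ := v_reduced_eq (σ := σ) hϖ hρ hx hζ hf V hV hG0 hb hu'
  obtain ⟨hvL'', hL0''⟩ := v_reduced_eq (σ := σ) hϖ hρ hx hζ hf V hV hG0 hb (mul_mem hu hu')
  have hσG : σ (f * gα + gβ) = f * gα + gβ := by rw [map_add, map_mul, hσf, hσgα, hσgβ]
  have hσL : ∀ {w : Fin 3 → Kˣ}, (∀ j, σ ((w j : Kˣ) : K) = w j) →
      σ ((1 + f) * gα * ((w 2 : Kˣ) : K) + (gβ - gα) * ((w 1 : Kˣ) : K)) = (1 + f) * gα * ((w 2 : Kˣ) : K) + (gβ - gα) * ((w 1 : Kˣ) : K) := fun hw => by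
    simp only [map_add, map_mul, map_sub, map_one, hσf, hσgα, hσgβ, hw]
  have huu'fix : ∀ j, σ (((u * u') j : Kˣ) : K) = (u * u') j := fun j => by rw [Pi.mul_apply, Units.val_mul, map_mul, hufix, hu'fix]
  -- abbreviations
  set G : K := f * gα + gβ with hG
  set L : K := (1 + f) * gα * ((u 2 : Kˣ) : K) + (gβ - gα) * ((u 1 : Kˣ) : K) with hL
  set L' : K := (1 + f) * gα * ((u' 2 : Kˣ) : K) + (gβ - gα) * ((u' 1 : Kˣ) : K) with hL'
  set L'' : K := (1 + f) * gα * (((u * u') 2 : Kˣ) : K) + (gβ - gα) * (((u * u') 1 : Kˣ) : K) with hL''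
  have hvG : 0 < Valued.v G := (Valuation.pos_iff _).2 hG0
  -- the defect `L·L′ − G·L″ = −(1+f)g_α(g_β−g_α)(u₂−u₁)(u′₂−u′₁)`
  have hdef : L * L' - G * L'' = -((1 + f) * gα * (gβ - gα) * ((((u 2 : Kˣ) : K) - u 1) * (((u' 2 : Kˣ) : K) - u' 1))) := by
    rw [hL, hL', hL'', hG, Pi.mul_apply, Pi.mul_apply, Units.val_mul, Units.val_mul]; ring
  have h1f : Valued.v (1 + f) ≤ 1 := (Valuation.map_add _ _ _).trans (max_le (le_of_eq (map_one _)) hf.le)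
  have hvdef : Valued.v (L * L' - G * L'') ≤ Valued.v ϖ ^ (2 * d - 1) * Valued.v (G * L'') := by
    rw [hdef, Valuation.map_neg, map_mul, map_mul, map_mul, map_mul, map_mul, hvL'']
    calc Valued.v (1 + f) * Valued.v gα * Valued.v (gβ - gα) * (Valued.v (((u 2 : Kˣ) : K) - u 1) * Valued.v (((u' 2 : Kˣ) : K) - u' 1))
        ≤ 1 * Valued.v gα * Valued.v G * (Valued.v ϖ ^ ρ * Valued.v ϖ ^ ρ) := mul_le_mul' (mul_le_mul' (mul_le_mul' h1f le_rfl) hb) (mul_le_mul' h10 h10')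
      _ = (Valued.v ϖ ^ (2 * ρ) * Valued.v gα) * Valued.v G := by rw [one_mul, ← pow_add, show ρ + ρ = 2 * ρ by ring]; ac_rfl
      _ ≤ (Valued.v ϖ ^ (2 * d - 1) * Valued.v G) * Valued.v G := mul_le_mul' hdom le_rfl
      _ = Valued.v ϖ ^ (2 * d - 1) * (Valued.v G * Valued.v G) := by rw [mul_assoc]
  -- hence `ω(L·L′) = ω(G·L″)`
  have hGL0 : G * L'' ≠ 0 := mul_ne_zero hG0 hL0''
  have hσGL : σ (G * L'') = G * L'' := by rw [map_mul, hσG, hσL huu'fix]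
  have hσLL : σ (L * L') = L * L' := by rw [map_mul, hσL hufix, hσL hu'fix]
  have hnear : normSign σ (L * L') = normSign σ (G * L'') := by
    -- `L·L′ = (G·L″)·y`, `|y − 1| ≤ |ϖ|^{2d−1}`
    obtain ⟨y, hy⟩ : ∃ y : K, y = (L * L') / (G * L'') := ⟨_, rfl⟩
    have hσy : σ y = y := by rw [hy, map_div₀, hσLL, hσGL]
    have hy1 : Valued.v (y - 1) ≤ Valued.v ϖ ^ (2 * d - 1) := by
      rw [hy, div_sub_one hGL0, map_div₀, div_le_iff₀ ((Valuation.pos_iff _).2 hGL0)]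
      exact hvdef
    have e : L * L' = (G * L'') * y := by rw [hy, mul_div_cancel₀ _ hGL0]
    rw [e, normSign_mul_eq_of_fixed_of_v_sub_one_le hD _ hσy le_rfl hy1]
  -- assemble: `ω(G)ω(L″) = ω(G·L″) = ω(L·L′) = ω(L)ω(L′)`, `ω(G)² = 1`
  have hsq : normSign σ G * normSign σ G = 1 := F0P3cDyRamDiagonalKappaSplitCountEval.normSign_mul_self σ G
  calc normSign σ G * normSign σ L'' = normSign σ (G * L'') := (normSign_mul_of_fixed hD hσG (hσL huu'fix) hG0 hL0'').symm
    _ = normSign σ (L * L') := hnear.symm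
    _ = normSign σ L * normSign σ L' := normSign_mul_of_fixed hD (hσL hufix) (hσL hu'fix) hL0 hL0'
    _ = (normSign σ G * normSign σ G) * (normSign σ L * normSign σ L') := by rw [hsq, one_mul]
    _ = (normSign σ G * normSign σ L) * (normSign σ G * normSign σ L') := by ring

end Summit.HodgeConjecture.HodgeConjecture.Cruxes.H413.F0P3cDyRamLabelledOddCoreHangingCharacterRead

end
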